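import Literature.NumberTheory.PAdicHodge.FontaineDpst
import Literature.NumberTheory.GaloisRepresentations.LocalGaloisGroupProofs
import Literature.NumberTheory.GaloisRepresentations.LocalGaloisGroupFrobeniusProofs
import HarnessLib

/-!
# `ReciprocityUpToIrreducibility` (stmt-Langlands-14328) — negative knowledge I:
# unramified twists of `p`-adic Hodge data, and what Fontaine's specification pins

Sorry-free, pure theorems, axioms `propext`/`Classical.choice`/`Quot.sound` (cdisprove cycle 1, seat
refuter-cdisprove-stmt-Langlands-14328-0; re-scoped 2026-08-17, see the repair note).  First half of
the obstruction recorded in `PinnedFontaineDatumUndecided`: the summit's `p`-adic Hodge datum at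
`v ∣ ℓ` is `fontainePstAdicCompletion v ℓ hv = Classical.epsilon (IsFontaineDatum _)`, and this file
showed that the clauses (F1)–(F7) of `IsFontaineDatum` are blind to UNRAMIFIED TWISTS of the relation
`IsWeilDeligneOf`:

* `exists_unrTwistWD` — every Weil–Deligne representation has an unramified twist by
  `w ↦ c ^ deg w` (same space, same `N`).
* `exists_unrTwistDatum` — for every datum `𝔇` and `c ∈ ℚ̄_ℓˣ` there is a datum `𝔇'` whose relation
  is "`r` is the `c`-twist of some `r₀` attached by `𝔇`", with the same de Rham and crystalline
  representations (the structure axioms are inherited; (F1)–(F3) see only the algebra structure and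
  the period ring, which are shared; (F4)–(F7) see `IsCrystallineFramed`, which is twist-invariant).
* `not_isWeilDeligneOf_one_trivial_of_unrTwist_neg_one` — `𝔇` and such a `(-1)`-twist cannot BOTH
  attach the trivial Weil–Deligne representation to the trivial rank-one representation (an arithmetic
  Frobenius has degree `1`, and `-1 ≠ 1` in `ℚ̄_ℓ`).
* `exists_not_isWeilDeligneOf_one_trivial` — hence the bare TYPE `PstWeilDeligneData F ℓ` always
  contains a datum violating the clause "`IsWeilDeligneOf 1 trivial`" (relevant because `fontainePst`
  is `Classical.epsilon`, which returns an arbitrary inhabitant when the specification is empty).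

**Repair / re-scoping 2026-08-17 (fullbuild breakage "159:4: Fields missing:
`isEquivalent_weilRestrict_of_isLocallyUnramified`").** The statement re-type of
`Literature/NumberTheory/PAdicHodge/FontaineDpst.lean` (2026-08-16T17:19Z, semantic-vacuity audit,
docs/m5/faithfulness/Langlands.md §4 row D(i)) ADDED to `IsFontaineDatum` the Frobenius-normalisation
clause (F8) `isEquivalent_weilRestrict_of_isLocallyUnramified` ("for unramified `ρ` every attached
Weil–Deligne representation is `≅ (ρ|_{W_F}, N = 0)`") — precisely the repair candidate (i) proposed
by the companion file, pinning the normalisation that (F1)–(F7) were shown here to leave open. With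
(F8) the specification DECIDES the clause: every datum with Fontaine's clauses attaches the trivial
Weil–Deligne representation to `1` (`isWeilDeligneOf_one_trivial_of_isFontaineDatum`: by (F8) an
attached `r₀` is `≅ (1, 0)`, and `(1, 0)` is rigid, `eq_trivial_of_isEquivalent_trivial`), so (F8)
is NOT inherited by the `(-1)`-twist (`not_isFontaineDatum_of_unrTwist_neg_one`,
`exists_unrTwistDatum_not_isFontaineDatum`): the twist construction now witnesses that (F8) is
independent of the seven other clauses plus the structure axioms. Consequently three records of the
first version became FALSE-whenever-non-vacuous and are kept (Theorems files are append-only) only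
as `@[deprecated]` aliases of their corrected content: `exists_isFontaineDatum_unrTwist` (its fourth
conjunct `IsFontaineDatum hℓ 𝔇 → IsFontaineDatum hℓ 𝔇'` fails for `c = -1`) ↦ `exists_unrTwistDatum`;
`exists_isFontaineDatum_not_isWeilDeligneOf_one_trivial` (relative non-pinning) ↦ its negation in
positive form `isWeilDeligneOf_one_trivial_of_isFontaineDatum`;
`exists_isFontaineDatum_not_isWeilDeligneOf_one_trivial_of_fontaineDatumExists` ↦
`isWeilDeligneOf_one_trivial_fontainePst`. The absolute form and the twist lemmas are unchanged.
[folklore]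
-/

noncomputable section

set_option linter.dupNamespace false -- project-wide option; `Summit.Langlands.Langlands` is the mandated namespace

open scoped MatrixGroups
open Field
open Literature.NumberTheory.Automorphic Literature.NumberTheory.GaloisRepresentations
open Literature.NumberTheory.PAdicHodge

namespace Summit.Langlands.Langlands.Theorems.ReciprocityUpToIrreducibility.Negative

variable {F : Type} [Field F] [ValuativeRel F] [TopologicalSpace F] [IsNonarchimedeanLocalField F]

/-- `deg` is additive (the named facts `IsFrobPow.mul/unique` are discharged in the tree). [folklore] -/
theorem deg_mul' (w w' : WeilGroup F) :
    WeilGroup.deg (w * w') = WeilGroup.deg w + WeilGroup.deg w' :=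
  WeilGroup.deg_mul IsFrobPow.mul_holds IsFrobPow.unique_holds w w'

/-- `deg 1 = 0`. [folklore] -/
theorem deg_one' : WeilGroup.deg (1 : WeilGroup F) = 0 :=
  WeilGroup.deg_one IsFrobPow.mul_holds IsFrobPow.unique_holds

/-- `deg` vanishes on inertia. [folklore] -/
theorem deg_eq_zero_of_mem_inertia' {u : WeilGroup F} (hu : u ∈ WeilGroup.inertia F) :
    WeilGroup.deg u = 0 :=
  (WeilGroup.deg_eq_zero_iff_mem_inertia IsFrobPow.mul_holds IsFrobPow.unique_holds).2 hu

/-- There is a Weil element of degree `1` (an arithmetic Frobenius). [folklore] -/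
theorem exists_deg_eq_one : ∃ w : WeilGroup F, WeilGroup.deg w = 1 :=
  WeilGroup.deg_surjective IsFrobPow.mul_holds IsFrobPow.unique_holds (exists_isFrobPow_holds F) 1

/-- **Unramified twists of Weil–Deligne representations exist**: for `c ∈ Cˣ` and `r₀` there is a
Weil–Deligne representation on the same space with `ρ(w) = c ^ deg w • ρ₀(w)` and the same `N`
(continuity: `deg = 0` on inertia; the Weil–Deligne relation: scalars commute). [folklore] -/
theorem exists_unrTwistWD {C : Type*} [Field C] [CharZero C] {V : Type*} [AddCommGroup V]
    [Module C V] (c : Cˣ) (r₀ : WeilDeligneRep F C V) :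
    ∃ r : WeilDeligneRep F C V, (∀ w, r.ρ w = ((c : C) ^ WeilGroup.deg w) • r₀.ρ w) ∧ r.N = r₀.N := by
  obtain ⟨U, hU, hUo, hker⟩ := r₀.isContinuous
  refine ⟨{ ρ := { toFun := fun w => ((c : C) ^ WeilGroup.deg w) • r₀.ρ w
                   map_one' := by rw [deg_one', zpow_zero, one_smul, map_one]
                   map_mul' := fun w w' => by
                     rw [deg_mul', zpow_add₀ c.ne_zero, map_mul, smul_mul_assoc, mul_smul_comm,
                       smul_smul] }
            isContinuous := ⟨U, hU, hUo, fun u hu => by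
              show ((c : C) ^ WeilGroup.deg u) • r₀.ρ u = 1
              rw [deg_eq_zero_of_mem_inertia' (hU hu), zpow_zero, one_smul, hker u hu]⟩
            N := r₀.N
            isNilpotent_N := r₀.isNilpotent_N
            conj_N := fun w => by
              show (((c : C) ^ WeilGroup.deg w) • r₀.ρ w) ∘ₗ r₀.N =
                ((IsNonarchimedeanLocalField.residueFieldCard F : C) ^ WeilGroup.deg w) •
                  (r₀.N ∘ₗ (((c : C) ^ WeilGroup.deg w) • r₀.ρ w))
              rw [LinearMap.smul_comp, LinearMap.comp_smul, r₀.conj_N w]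
              exact smul_comm _ _ _ }, fun _ => rfl, rfl⟩

variable {ℓ : ℕ} [Fact ℓ.Prime]

/-- **The trivial Weil–Deligne representation is rigid**: a Weil–Deligne representation on `V`
isomorphic to `(1, N = 0)` on `V` IS `(1, 0)` — the intertwiner conjugates each `ρ(w)` to the identity
and `N` to `0`, and the remaining fields are propositions. [folklore] -/
theorem eq_trivial_of_isEquivalent_trivial {C : Type*} [Field C] [CharZero C] {V : Type*}
    [AddCommGroup V] [Module C V] (r : WeilDeligneRep F C V)
    (h : r.IsEquivalent (WeilDeligneRep.trivial C V)) :
    r = WeilDeligneRep.trivial C V := by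
  obtain ⟨e⟩ := h
  have hinj : Function.Injective e.toRepEquiv := EquivLike.injective e.toRepEquiv
  have hρ : ∀ w x, r.ρ w x = x := fun w x => hinj <| by
    have h1 := congr($(e.toRepEquiv.isIntertwining' w) x)
    simp only [LinearMap.coe_comp, Function.comp_apply, WeilDeligneRep.trivial,
      WeilDeligneRep.ofRep_ρ, Representation.trivial_apply, Representation.Equiv.coe_toLinearMap] at h1
    exact h1
  have hN : ∀ x, r.N x = 0 := fun x => hinj <| by
    have h2 := congr($(e.comm_N) x)
    simp only [LinearMap.coe_comp, Function.comp_apply, WeilDeligneRep.trivial,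
      WeilDeligneRep.ofRep_N, LinearMap.zero_apply, Representation.Equiv.coe_toLinearMap] at h2
    rw [map_zero]
    exact h2
  obtain ⟨ρ, hc, N, hn, hconj⟩ := r
  have hρ' : ρ = Representation.trivial C (WeilGroup F) V :=
    MonoidHom.ext fun w => LinearMap.ext fun x => by rw [Representation.trivial_apply]; exact hρ w x
  have hN' : N = 0 := LinearMap.ext fun x => hN x
  subst hρ' hN'
  rfl

/-- **(F8) decides the clause (F1)–(F7) left open.** Under Fontaine's clauses — as re-typed
2026-08-16 with the Frobenius-normalisation clause (F8) — EVERY datum attaches the trivial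
Weil–Deligne representation `(1, N = 0)` to the trivial rank-`n` representation: some `r₀` is
attached (unramified ⇒ de Rham ⇒ attached), `r₀ ≅ (1, 0)` by (F8)
(`IsFontaineDatum.isEquivalent_trivial_of_isWeilDeligneOf_one`), and `(1, 0)` is rigid
(`eq_trivial_of_isEquivalent_trivial`). [cite: FontaineAsterisque223VIII, §1.3 and §2.3.7] -/
theorem isWeilDeligneOf_one_trivial_of_isFontaineDatum [CharZero F]
    {hℓ : ValuativeRel.valuation F ℓ < 1} {𝔇 : PstWeilDeligneData F ℓ} (h : IsFontaineDatum hℓ 𝔇)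
    {n : ℕ} :
    𝔇.IsWeilDeligneOf (1 : FramedRep (absoluteGaloisGroup F) (PadicAlgCl ℓ) n)
      (WeilDeligneRep.trivial (PadicAlgCl ℓ) (Fin n → PadicAlgCl ℓ)) := by
  obtain ⟨⟨r₀, hr₀⟩, -⟩ :=
    h.isWeilDeligneOf_of_isLocallyUnramified (FramedRep.isLocallyUnramified_one (n := n))
  rwa [← eq_trivial_of_isEquivalent_trivial r₀ (h.isEquivalent_trivial_of_isWeilDeligneOf_one hr₀)]

/-- **The pinned datum attaches `(1, 0)` to `1`** (under `FontaineDatumExists`, which puts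
`fontainePst F ℓ hℓ = Classical.epsilon (IsFontaineDatum hℓ)` inside the specification): the
instance formerly recorded here as undecided by the specification. [folklore] -/
theorem isWeilDeligneOf_one_trivial_fontainePst [CharZero F] (hF : FontaineDatumExists)
    (hℓ : ValuativeRel.valuation F ℓ < 1) {n : ℕ} :
    (fontainePst F ℓ hℓ).IsWeilDeligneOf (1 : FramedRep (absoluteGaloisGroup F) (PadicAlgCl ℓ) n)
      (WeilDeligneRep.trivial (PadicAlgCl ℓ) (Fin n → PadicAlgCl ℓ)) :=
  isWeilDeligneOf_one_trivial_of_isFontaineDatum (isFontaineDatum_fontainePst hF hℓ)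

/-- **Unramified twist of a `p`-adic Hodge datum.** For every datum `𝔇` and `c ∈ ℚ̄_ℓˣ` there is
a datum `𝔇'` with: `IsWeilDeligneOf' ρ r ⇔ r` is the unramified `c`-twist of some `r₀` with
`𝔇.IsWeilDeligneOf ρ r₀`; and the same class of de Rham and of crystalline representations.
Construction: same `ℚ_ℓ`-algebra structure and period ring; the five structure axioms are inherited
(uniqueness up to isomorphism: the same intertwiner works; the unramified case: `deg = 0` on inertia).
Clauses (F1)–(F7) of `IsFontaineDatum` pass from `𝔇` to `𝔇'` by the same transports, but (F8) does
NOT (`not_isFontaineDatum_of_unrTwist_neg_one`), which is why the 2026-08-16 version's fourth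
conjunct `IsFontaineDatum hℓ 𝔇 → IsFontaineDatum hℓ 𝔇'` is gone (repair note). [folklore] -/
theorem exists_unrTwistDatum (𝔇 : PstWeilDeligneData F ℓ) (c : (PadicAlgCl ℓ)ˣ) :
    ∃ 𝔇' : PstWeilDeligneData F ℓ,
      (∀ {n : ℕ} (ρ : FramedRep (absoluteGaloisGroup F) (PadicAlgCl ℓ) n)
          (r : WeilDeligneRep F (PadicAlgCl ℓ) (Fin n → PadicAlgCl ℓ)),
          𝔇'.IsWeilDeligneOf ρ r ↔ ∃ r₀, 𝔇.IsWeilDeligneOf ρ r₀ ∧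
            (∀ w, r.ρ w = ((c : PadicAlgCl ℓ) ^ WeilGroup.deg w) • r₀.ρ w) ∧ r.N = r₀.N) ∧
      (∀ {n : ℕ} (ρ : FramedRep (absoluteGaloisGroup F) (PadicAlgCl ℓ) n),
          𝔇'.IsDeRhamFramed ρ ↔ 𝔇.IsDeRhamFramed ρ) ∧
      (∀ {n : ℕ} (ρ : FramedRep (absoluteGaloisGroup F) (PadicAlgCl ℓ) n),
          𝔇'.IsCrystallineFramed ρ ↔ 𝔇.IsCrystallineFramed ρ) := by
  let 𝔇' : PstWeilDeligneData F ℓ :=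
    { algebra := 𝔇.algebra
      𝔅 := 𝔇.𝔅
      IsWeilDeligneOf := fun ρ r => ∃ r₀, 𝔇.IsWeilDeligneOf ρ r₀ ∧
        (∀ w, r.ρ w = ((c : PadicAlgCl ℓ) ^ WeilGroup.deg w) • r₀.ρ w) ∧ r.N = r₀.N
      exists_of_isDeRham := fun ρ hρ => by
        obtain ⟨r₀, h⟩ := 𝔇.exists_of_isDeRham ρ hρ
        obtain ⟨r, hr, hN⟩ := exists_unrTwistWD c r₀
        exact ⟨r, r₀, h, hr, hN⟩
      isEquivalent := fun ρ r r' hr hr' => by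
        obtain ⟨r₀, h₀, hρ₀, hN₀⟩ := hr
        obtain ⟨r₁, h₁, hρ₁, hN₁⟩ := hr'
        obtain ⟨e⟩ := 𝔇.isEquivalent ρ r₀ r₁ h₀ h₁
        have he : ∀ w, (e.toLinearEquiv : (Fin _ → PadicAlgCl ℓ) →ₗ[PadicAlgCl ℓ] _) ∘ₗ r.ρ w =
            r'.ρ w ∘ₗ (e.toLinearEquiv : (Fin _ → PadicAlgCl ℓ) →ₗ[PadicAlgCl ℓ] _) := fun w => by
          rw [hρ₀ w, hρ₁ w, LinearMap.comp_smul, LinearMap.smul_comp]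
          exact congrArg _ (e.toRepEquiv.isIntertwining' w)
        refine ⟨⟨Representation.Equiv.mk e.toLinearEquiv he, ?_⟩⟩
        show (e.toLinearEquiv : (Fin _ → PadicAlgCl ℓ) →ₗ[PadicAlgCl ℓ] _) ∘ₗ r.N =
          r'.N ∘ₗ (e.toLinearEquiv : (Fin _ → PadicAlgCl ℓ) →ₗ[PadicAlgCl ℓ] _)
        rw [hN₀, hN₁]
        exact e.comm_N
      conj := fun g ρ r hr => by
        obtain ⟨r₀, h₀, h⟩ := hr
        exact ⟨r₀, 𝔇.conj g ρ r₀ h₀, h⟩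
      isDeRhamWith_of_isLocallyUnramified := 𝔇.isDeRhamWith_of_isLocallyUnramified
      wd_of_isLocallyUnramified := fun ρ r hρ hr => by
        obtain ⟨r₀, h₀, hρ₀, hN₀⟩ := hr
        obtain ⟨hN, hunr⟩ := 𝔇.wd_of_isLocallyUnramified ρ r₀ hρ h₀
        refine ⟨hN₀.trans hN, fun u hu => ?_⟩
        rw [hρ₀ u, deg_eq_zero_of_mem_inertia' hu, zpow_zero, one_smul]
        exact hunr u hu }
  -- the class of crystalline representations is twist-invariant
  have hC : ∀ {n : ℕ} (ρ : FramedRep (absoluteGaloisGroup F) (PadicAlgCl ℓ) n),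
      𝔇'.IsCrystallineFramed ρ ↔ 𝔇.IsCrystallineFramed ρ := by
    intro n ρ
    constructor
    · rintro ⟨hdR, r, ⟨r₀, h₀, hρ, hN⟩, hN0, hunr⟩
      refine ⟨hdR, r₀, h₀, by rw [← hN]; exact hN0, fun u hu => ?_⟩
      have h := hunr u hu
      rw [hρ u, deg_eq_zero_of_mem_inertia' hu, zpow_zero, one_smul] at h
      exact h
    · rintro ⟨hdR, r₀, h₀, hN0, hunr⟩
      obtain ⟨r, hr, hN⟩ := exists_unrTwistWD c r₀
      refine ⟨hdR, r, ⟨r₀, h₀, hr, hN⟩, hN.trans hN0, fun u hu => ?_⟩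
      rw [hr u, deg_eq_zero_of_mem_inertia' hu, zpow_zero, one_smul]
      exact hunr u hu
  exact ⟨𝔇', fun ρ r => Iff.rfl, fun ρ => Iff.rfl, hC⟩

/-- **Deprecated record.** Formerly `exists_unrTwistDatum` with a fourth conjunct
`IsFontaineDatum hℓ 𝔇 → IsFontaineDatum hℓ 𝔇'` ((F1)–(F7) are twist-invariant). Since the 2026-08-16
re-type of `IsFontaineDatum` that conjunct is FALSE for `c = -1` whenever `IsFontaineDatum hℓ 𝔇`
((F8) is not inherited: `not_isFontaineDatum_of_unrTwist_neg_one`), so the name is kept as an alias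
of the three-conjunct construction. [folklore] -/
@[deprecated exists_unrTwistDatum (since := "2026-08-17")]
alias exists_isFontaineDatum_unrTwist := exists_unrTwistDatum

/-- **A datum and its `(-1)`-twist cannot both attach the trivial Weil–Deligne representation to
the trivial rank-one representation**: the two attached representations would be isomorphic
(`isEquivalent`), forcing `(-1) ^ deg w = 1` at an arithmetic Frobenius, i.e. `-1 = 1` in `ℚ̄_ℓ`.
[folklore] -/
theorem not_isWeilDeligneOf_one_trivial_of_unrTwist_neg_one (𝔇 𝔇' : PstWeilDeligneData F ℓ)
    (h𝔇' : ∀ {n : ℕ} (ρ : FramedRep (absoluteGaloisGroup F) (PadicAlgCl ℓ) n)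
        (r : WeilDeligneRep F (PadicAlgCl ℓ) (Fin n → PadicAlgCl ℓ)),
        𝔇'.IsWeilDeligneOf ρ r ↔ ∃ r₀, 𝔇.IsWeilDeligneOf ρ r₀ ∧
          (∀ w, r.ρ w = (((-1 : (PadicAlgCl ℓ)ˣ) : PadicAlgCl ℓ) ^ WeilGroup.deg w) • r₀.ρ w) ∧
            r.N = r₀.N) :
    ¬ (𝔇.IsWeilDeligneOf (1 : FramedRep (absoluteGaloisGroup F) (PadicAlgCl ℓ) 1)
          (WeilDeligneRep.trivial (PadicAlgCl ℓ) (Fin 1 → PadicAlgCl ℓ)) ∧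
       𝔇'.IsWeilDeligneOf (1 : FramedRep (absoluteGaloisGroup F) (PadicAlgCl ℓ) 1)
          (WeilDeligneRep.trivial (PadicAlgCl ℓ) (Fin 1 → PadicAlgCl ℓ))) := by
  rintro ⟨h1, h2⟩
  obtain ⟨r₀, h₀, hρ, -⟩ := (h𝔇' _ _).1 h2
  obtain ⟨e⟩ := 𝔇.isEquivalent _ _ _ h1 h₀
  obtain ⟨w, hw⟩ := exists_deg_eq_one (F := F)
  -- `r₀.ρ w = id`: transport through `e : trivial ≃ r₀`
  have hid : ∀ y, r₀.ρ w y = y := by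
    intro y
    obtain ⟨x, rfl⟩ := e.toLinearEquiv.surjective y
    have h := congrArg (fun f => f x) (e.toRepEquiv.isIntertwining' w)
    simp only [LinearMap.coe_comp, Function.comp_apply, WeilDeligneRep.trivial,
      WeilDeligneRep.ofRep_ρ, Representation.trivial_apply] at h
    exact h.symm
  -- the twist relation at `w`: `id = (-1) • id`
  have h3 := congrArg (fun f => f (fun _ => (1 : PadicAlgCl ℓ))) (hρ w)
  simp only [WeilDeligneRep.trivial, WeilDeligneRep.ofRep_ρ, Representation.trivial_apply,
    LinearMap.smul_apply, hid, hw, zpow_one, Units.val_neg, Units.val_one, neg_smul, one_smul] at h3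
  have h4 := congrFun h3 0
  simp only [Pi.neg_apply] at h4
  have h5 : (2 : PadicAlgCl ℓ) = 0 := by linear_combination h4
  exact two_ne_zero h5

/-- **(F8) is not inherited by the `(-1)`-twist.** If `𝔇` satisfies Fontaine's clauses then a
datum `𝔇'` attaching the `(-1)`-twists of what `𝔇` attaches does NOT: both would attach `(1, 0)` to
`1` (`isWeilDeligneOf_one_trivial_of_isFontaineDatum`), contradicting
`not_isWeilDeligneOf_one_trivial_of_unrTwist_neg_one`. So the Frobenius-normalisation clause (F8) is
independent of (F1)–(F7) and the structure axioms — the twist-blindness of the 2026-08-16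
specification, now DETECTED by the re-typed one. [folklore] -/
theorem not_isFontaineDatum_of_unrTwist_neg_one [CharZero F] {hℓ : ValuativeRel.valuation F ℓ < 1}
    (𝔇 𝔇' : PstWeilDeligneData F ℓ)
    (h𝔇' : ∀ {n : ℕ} (ρ : FramedRep (absoluteGaloisGroup F) (PadicAlgCl ℓ) n)
        (r : WeilDeligneRep F (PadicAlgCl ℓ) (Fin n → PadicAlgCl ℓ)),
        𝔇'.IsWeilDeligneOf ρ r ↔ ∃ r₀, 𝔇.IsWeilDeligneOf ρ r₀ ∧
          (∀ w, r.ρ w = (((-1 : (PadicAlgCl ℓ)ˣ) : PadicAlgCl ℓ) ^ WeilGroup.deg w) • r₀.ρ w) ∧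
            r.N = r₀.N)
    (h : IsFontaineDatum hℓ 𝔇) : ¬ IsFontaineDatum hℓ 𝔇' := fun h' =>
  not_isWeilDeligneOf_one_trivial_of_unrTwist_neg_one 𝔇 𝔇' h𝔇'
    ⟨isWeilDeligneOf_one_trivial_of_isFontaineDatum h, isWeilDeligneOf_one_trivial_of_isFontaineDatum h'⟩

/-- **Independence of (F8), witnessed.** For every datum with Fontaine's clauses there is a datum
with the same `ℚ_ℓ`-structure, period ring, de Rham and crystalline representations, attaching the
`(-1)`-twists of the attached Weil–Deligne representations — hence with (F1)–(F7) — which violates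
the specification (it fails (F8)). [folklore] -/
theorem exists_unrTwistDatum_not_isFontaineDatum [CharZero F]
    {hℓ : ValuativeRel.valuation F ℓ < 1} {𝔇 : PstWeilDeligneData F ℓ} (h : IsFontaineDatum hℓ 𝔇) :
    ∃ 𝔇' : PstWeilDeligneData F ℓ,
      (∀ {n : ℕ} (ρ : FramedRep (absoluteGaloisGroup F) (PadicAlgCl ℓ) n)
          (r : WeilDeligneRep F (PadicAlgCl ℓ) (Fin n → PadicAlgCl ℓ)),
          𝔇'.IsWeilDeligneOf ρ r ↔ ∃ r₀, 𝔇.IsWeilDeligneOf ρ r₀ ∧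
            (∀ w, r.ρ w = (((-1 : (PadicAlgCl ℓ)ˣ) : PadicAlgCl ℓ) ^ WeilGroup.deg w) • r₀.ρ w) ∧
              r.N = r₀.N) ∧
      (∀ {n : ℕ} (ρ : FramedRep (absoluteGaloisGroup F) (PadicAlgCl ℓ) n),
          𝔇'.IsDeRhamFramed ρ ↔ 𝔇.IsDeRhamFramed ρ) ∧
      (∀ {n : ℕ} (ρ : FramedRep (absoluteGaloisGroup F) (PadicAlgCl ℓ) n),
          𝔇'.IsCrystallineFramed ρ ↔ 𝔇.IsCrystallineFramed ρ) ∧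
      ¬ IsFontaineDatum hℓ 𝔇' := by
  obtain ⟨𝔇', hW, hdR, hC⟩ := exists_unrTwistDatum 𝔇 (-1)
  exact ⟨𝔇', hW, hdR, hC, not_isFontaineDatum_of_unrTwist_neg_one 𝔇 𝔇' hW h⟩

/-- **Deprecated record.** Formerly "non-pinning, relative form": `IsFontaineDatum hℓ 𝔇 → ∃ 𝔇',
IsFontaineDatum hℓ 𝔇' ∧ ¬ 𝔇'.IsWeilDeligneOf 1 trivial` — true of the 2026-08-16 specification
(F1)–(F7), FALSE whenever non-vacuous for the re-typed one: with (F8) every datum with the clauses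
attaches `(1, 0)` to `1`. The name is kept as an alias of that positive statement. [folklore] -/
@[deprecated isWeilDeligneOf_one_trivial_of_isFontaineDatum (since := "2026-08-17")]
alias exists_isFontaineDatum_not_isWeilDeligneOf_one_trivial :=
  isWeilDeligneOf_one_trivial_of_isFontaineDatum

/-- **Non-pinning, absolute form.** The TYPE `PstWeilDeligneData F ℓ` always contains a datum not
attaching the trivial Weil–Deligne representation to `1` (twist the truncated model if necessary) —
relevant because `fontainePst` is `Classical.epsilon`, which returns an arbitrary inhabitant when the
specification is empty. [folklore] -/
theorem exists_not_isWeilDeligneOf_one_trivial [CharZero F] (hℓ : ValuativeRel.valuation F ℓ < 1) :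
    ∃ 𝔇 : PstWeilDeligneData F ℓ,
      ¬ 𝔇.IsWeilDeligneOf (1 : FramedRep (absoluteGaloisGroup F) (PadicAlgCl ℓ) 1)
          (WeilDeligneRep.trivial (PadicAlgCl ℓ) (Fin 1 → PadicAlgCl ℓ)) := by
  letI := LocalField.padicAlgebra F ℓ hℓ
  by_cases h1 : (unramifiedPstWeilDeligneData F ℓ).IsWeilDeligneOf
      (1 : FramedRep (absoluteGaloisGroup F) (PadicAlgCl ℓ) 1)
      (WeilDeligneRep.trivial (PadicAlgCl ℓ) (Fin 1 → PadicAlgCl ℓ))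
  · obtain ⟨𝔇', hW, -, -⟩ := exists_unrTwistDatum (unramifiedPstWeilDeligneData F ℓ) (-1)
    exact ⟨𝔇', fun h2 => not_isWeilDeligneOf_one_trivial_of_unrTwist_neg_one _ 𝔇' hW ⟨h1, h2⟩⟩
  · exact ⟨_, h1⟩

/-- **Deprecated record.** Formerly: under `FontaineDatumExists`, at every local field some datum with
all of Fontaine's clauses fails the clause `IsWeilDeligneOf 1 trivial` — FALSE for the re-typed
specification, under which the pinned datum `fontainePst F ℓ hℓ` itself satisfies it
(`isWeilDeligneOf_one_trivial_fontainePst`); the name is kept as an alias of that statement.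
[folklore] -/
@[deprecated isWeilDeligneOf_one_trivial_fontainePst (since := "2026-08-17")]
alias exists_isFontaineDatum_not_isWeilDeligneOf_one_trivial_of_fontaineDatumExists :=
  isWeilDeligneOf_one_trivial_fontainePst

end Summit.Langlands.Langlands.Theorems.ReciprocityUpToIrreducibility.Negative

end
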